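import Summits.QuantumFields.YangMills.Theorems.BalabanUVNodesK0V23Stub3FlowGronwallDoor
import Summits.QuantumFields.YangMills.Theorems.BalabanUVNodesK0V23DefsAx

/-!
# K0ᴬ (stmt-QuantumFields-27238 `Record13SepCoPHInhabitedAx`) — THE «FLOW-GRÖNWALL» DOOR RE-CENTRED (H3.3 Ax edition of `…K0V23Stub3FlowGronwallDoor` §3–§4):
# the four one-step rows at the V24 stub's own RE-CENTRED member ⟹ the REGISTERED V24 stub-3ᴬ′ᴮ text `K0V23DefsAx.AbsBetaBoxAtThm1WitnessCCMGenGridGZBAxAt F` BY NAME,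
# and the radius-axis edition ⟹ the body of door (α_small) `K0BoxSmallRadiiAx` at `F`

Cell `pub-ymgap` (YM-PLAN Track A, D-0062), width seat `pub-ymgap-dag-n07-w3` (g23).  `--kind proof --supports stmt-QuantumFields-27238 --as helper` (K0ᴬ), COUNT-NEUTRAL.
NEW leaf (body-freeze №460 (2): nothing of `…K0V23Stub3FlowGronwallDoor` (dag-n07-w3 g18, ✓p781946 ∕ v1.1 ✓p783667) is edited; its CENTRE-BLIND §0–§2 ∕ §5 — the discrete Grönwall
over scales for box histories `size_le_of_stepHistOn` ∕ `size_le_of_stepLastOn`, the readout `abs_le_of_readoutOn` ∕ `betaBox_of_readoutOn` ∕ `betaBox_of_flowRowsHistOn`,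
`gronwall_level_nonneg`, the format-predicate editions — are REUSED BY NAME, not restated).  0 `def` ∕ 0 `sorry` ∕ 0 `instance` ∕ 0 `notation`; standard axioms.
[I] = [Balaban1987RG1]; [II] = [Balaban1989LargeFieldII]; [15] = [Balaban1985Variational].

WHY.  Director-ym №467 (D) ∕ route rev 31–36: K0⁷ `Record13SepCoPHInhabited` (stmt-QuantumFields-20541) is banked as an aside and K0ᴬ `Record13SepCoPHInhabitedAx` is its
re-centred successor; plan g99's V24 skeleton (`K0Skeleton13SepCoPHV24.lean` f6daae17…, registered 2026-08-31T03:32:50Z) keys the REGISTERED stub 3ᴬ′ᴮ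
`stub_absBetaBoxAtThm1WitnessCCMGenGridGZBAx13 : ∀ F, K0V23DefsAx.AbsBetaBoxAtThm1WitnessCCMGenGridGZBAxAt F` — the sign-free |β| box of the BLOCK-AXIAL β of record
`betaOfRecord₁₃Ax` at def-Y's re-pinned witness `theta13OfThm1CCMWZBAx F 2 j ½ a₀ ε₀ ε₂₉ B₃ B₃' a₀ a₁ 0 0` (dag-n07-w3 g22 ✓p803783).  The bare module's §3–§4 are the ONLY
centred declarations of NODE O DOOR LEAF №2 (lens-2 «flow-gronwall-ttel», CRIT-1-repaired: box-restricted rows, coupling-independent source, full memory): they read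
`betaOfRecord₁₃ F 2 (theta13OfThm1CCMWZB …)` and conclude the V23 text ∕ the V23 door body.  This file is their σ-image (`betaOfRecord₁₃ ↦ betaOfRecord₁₃Ax`,
`theta13OfThm1CCMWZB ↦ theta13OfThm1CCMWZBAx`, `K0V23Defs.AbsBetaBoxAtThm1WitnessCCMGenGridGZBAt ↦ K0V23DefsAx.AbsBetaBoxAtThm1WitnessCCMGenGridGZBAxAt`,
door body `K0V23Stub3DoorSuppliers.K0BoxSmallRadii ↦ K0V23Stub3DoorSuppliersAx.K0BoxSmallRadiiAx` — UNFOLDED here, so this leaf does not import the DEF-1∕g22 door module);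
every other byte of the statements and every proof is the bare module's, the Grönwall ∕ readout lemmas applied BY NAME (they are generic in `β : HBeta`).
* §1 ★★ `absBetaBoxGZBAxAt_of_flowRowsHistAt` — the FOUR ROWS (full-memory step, base, readout + base readout, cap) at each member `(j; B₃ ≥ 2L², B₃′, a₀, a₁ > 0)` for that
  member's RE-CENTRED β ⟹ `AbsBetaBoxAtThm1WitnessCCMGenGridGZBAxAt F` (the grid letters `c, c₀, c₁` and the ᴮ (8)∕(9) antecedents are not used; `β′`, `γ₀ := γ`, `ε₀`, `ε₂₉`
  ∃-chosen per member, as the text allows); `absBetaBoxGZBAxAt_of_flowRowsLastAt` — last-level step row edition.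
* §2 ★★ `k0BoxSmallRadiiAxAt_of_flowRowsHist` — RADIUS-AXIS edition: the rows at ONE re-centred member per SMALL radius `a₀ ≤ a⋆` ⟹ the body of door (α_small)
  `K0V23Stub3DoorSuppliersAx.K0BoxSmallRadiiAx` AT `F`, unfolded (compose with ✓p809897 `record13SepCoPHInhabitedAx_of_k0BoxSmallRadii` by one `fun F => …`; the composed
  form lands in the Ax edition of `…K0V23Stub3FlowGronwallRadiusDoors`).

HONEST FRAMING (binding).  [folklore] real analysis applied by name + two by-name doors; the four rows are DISPLAYED HYPOTHESES inhabited nowhere — with `e` unpinned they are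
an INTERFACE, not a claim, and when `e` is the record's pinned size functional the step row IS NODE O's wall at one step ([I] §1 p.264 «uniformly bounded» ∕ Thm 3's (1.18)
heredity, STATED, proof unpublished [II] p.355).  This file prices nothing and discharges nothing of Bałaban; NO β estimate; stub 3ᴬ′ᴮ NOT proved; K0ᴬ stmt-QuantumFields-27238
∕ K1ᴬ 27239 ∕ K3ᴬ 27247 OPEN, not claimed; K0⁷ 20541 aside, untouched; NODE O NOT inhabited; N07 NOT discharged; COUNT 8∕28 · K 1∕4 UNMOVED; R4 = the CONDITIONAL finite-𝕋⁴
rung `BalabanLadder.UV` at fixed `ε = L^(−K)` only — NOT continuum ∕ ℝ⁴ ∕ OS; the Yang–Mills mass gap (Clay) is NOT proved by any of this.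
-/

noncomputable section

namespace Summit.QuantumFields.YangMills.Theorems.K0V23Stub3FlowGronwallDoorAx

open Literature.MathematicalPhysics.QuantumFieldTheory.Balaban1983to89
open Literature.MathematicalPhysics.QuantumFieldTheory.Balaban1983to89.Node00
open Literature.MathematicalPhysics.QuantumFieldTheory.Balaban1983to89.T4Continuum
open Literature.MathematicalPhysics.QuantumFieldTheory.Balaban1983to89.FlowStep
open Summit.QuantumFields.YangMills.Theorems.K0V23DefsAx (AbsBetaBoxAtThm1WitnessCCMGenGridGZBAxAt)
open Summit.QuantumFields.YangMills.Theorems.K0V23Stub3FlowGronwallDoor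
  (gronwall_level_nonneg size_le_of_stepLastOn betaBox_of_readoutOn betaBox_of_flowRowsHistOn)

/-! ## §1. LOCATED-B BY NAME, RE-CENTRED: the four rows at the stub's own re-centred member ⟹ the registered V24 stub-3ᴬ′ᴮ text -/

/-- **★★ THE FLOW-GRÖNWALL ROWS AT EACH RE-CENTRED MEMBER ⟹ `AbsBetaBoxAtThm1WitnessCCMGenGridGZBAxAt F`** (σ-image of `K0V23Stub3FlowGronwallDoor.absBetaBoxGZBAt_of_flowRowsHistAt`).
For every member `(j; B₃ ≥ 2L², B₃′ > 0, a₀ > 0, a₁ > 0)` of the stub's family let there be window tokens `ε₀, ε₂₉ > 0`, box sides `0 < γ ≤ γ̄` and flow data (a history-indexed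
size functional `e`, a centre sequence `b`, constants `θ, b₀, b₁, Λ, A, a₀′, a₁′, B ≥ 0`, a slack `A₀`, with `θ + γΛ < 1`) carrying the FOUR ROWS on `Box γ̄` for that member's
RE-CENTRED β of record `betaOfRecord₁₃Ax F 2 (theta13OfThm1CCMWZBAx F 2 j (1/2) a₀ ε₀ ε₂₉ B₃ B₃' a₀ a₁ 0 0)` — full-memory step, base, readout (+ base readout), cap.  Then the
REGISTERED V24 stub-3ᴬ′ᴮ text holds at `F` (the grid letters and the ᴮ (8)∕(9) antecedents are not used; `β′`, `γ₀ := γ` are ∃-chosen per member, as the text allows).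
CONDITIONAL on the rows — with `e` the record's pinned size functional the step row is NODE O's wall at one step; nothing of Bałaban asserted; K0ᴬ NOT closed.
[cite: Balaban1987RG1, Thm 1 p.259, §1 p.264, (1.18) p.263, (1.20)–(1.22) p.264, (2.9) p.266; Balaban1985Variational, Thm 1 (8),(9) p.279; Balaban1989LargeFieldII, p.355] -/
theorem absBetaBoxGZBAxAt_of_flowRowsHistAt (F : T4Family)
    (h : ∀ (j : ℕ) (B₃ B₃' a₀ a₁ : ℝ), 2 * (F.L : ℝ) ^ 2 ≤ B₃ → 0 < B₃' → 0 < a₀ → 0 < a₁ →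
      ∃ (ε₀ ε₂₉ γ γbar : ℝ) (e : (k : ℕ) → (Fin (k + 1) → ℝ) → ℝ) (b : ℕ → ℝ) (θ b₀ b₁ Λ A₀ A a₀' a₁' B : ℝ),
        0 < ε₀ ∧ 0 < ε₂₉ ∧ 0 < γ ∧ γ ≤ γbar ∧ 0 ≤ θ ∧ 0 ≤ b₀ ∧ 0 ≤ b₁ ∧ 0 ≤ Λ ∧ θ + γ * Λ < 1 ∧ 0 ≤ A ∧ 0 ≤ a₀' ∧ 0 ≤ a₁' ∧
        letI β : HBeta := betaOfRecord₁₃Ax F 2 (theta13OfThm1CCMWZBAx F 2 j (1 / 2) a₀ ε₀ ε₂₉ B₃ B₃' a₀ a₁ (fun _ _ => 0) (fun _ _ => 0))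
        (∀ (k : ℕ) (v : Fin (k + 2) → ℝ) (E : ℝ), v ∈ Box γbar (k + 1) → 0 ≤ E →
          (∀ (i : ℕ) (hi : i + 1 ≤ k + 1), e i (fun t => v (Fin.castLE (hi.trans (Nat.le_succ _)) t)) ≤ E) →
          e (k + 1) v ≤ θ * E + b₀ + v (Fin.last (k + 1)) * (b₁ + Λ * E)) ∧
        (∀ v : Fin 1 → ℝ, v ∈ Box γbar 0 → e 0 v ≤ b₀ + v 0 * b₁) ∧
        (∀ v : Fin 1 → ℝ, v ∈ Box γbar 0 → |β 0 v - b 0| ≤ A₀ + v 0 * a₀') ∧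
        (∀ (k : ℕ) (v : Fin (k + 2) → ℝ), v ∈ Box γbar (k + 1) →
          |β (k + 1) v - b (k + 1)| ≤ A₀ + A * e k (Fin.init v) + v (Fin.last (k + 1)) * (a₀' + a₁' * e k (Fin.init v))) ∧
        (∀ k, |b k| ≤ B)) :
    AbsBetaBoxAtThm1WitnessCCMGenGridGZBAxAt F := by
  intro j c c₀ c₁ B₃ B₃' a₀ a₁ _hc _hc₀ _hc₁ hB₃ hB₃' ha₀ ha₁ _h15 _h9
  obtain ⟨ε₀, ε₂₉, γ, γbar, e, b, θ, b₀, b₁, Λ, A₀, A, a₀', a₁', B, hε₀, hε₂₉, hγ, hγbar, hθ, hb₀, hb₁, hΛ, hgap, hA, ha₀', ha₁',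
    hstep, hbase, hread0, hread, hcap⟩ := h j B₃ B₃' a₀ a₁ hB₃ hB₃' ha₀ ha₁
  obtain ⟨hlo, hup⟩ := betaBox_of_flowRowsHistOn hθ hb₀ hb₁ hΛ hγ.le hγbar hgap hA ha₀' ha₁' hstep hbase hread0 hread hcap
  exact ⟨γ, ε₀, ε₂₉, _, hγ, hε₀, hε₂₉, hlo, hup⟩

/-- **THE LAST-LEVEL EDITION, RE-CENTRED** (σ-image of `K0V23Stub3FlowGronwallDoor.absBetaBoxGZBAt_of_flowRowsLastAt`; lens-2's `StepContractionOn`-shaped step row with a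
constant source `b₀`): the same door into the registered V24 stub-3ᴬ′ᴮ text.  CONDITIONAL on the rows; nothing of Bałaban asserted.
[cite: Balaban1987RG1, Thm 1 p.259, §1 p.264, (1.18) p.263, (2.9) p.266; Balaban1985Variational, Thm 1 (8),(9) p.279] -/
theorem absBetaBoxGZBAxAt_of_flowRowsLastAt (F : T4Family)
    (h : ∀ (j : ℕ) (B₃ B₃' a₀ a₁ : ℝ), 2 * (F.L : ℝ) ^ 2 ≤ B₃ → 0 < B₃' → 0 < a₀ → 0 < a₁ →
      ∃ (ε₀ ε₂₉ γ γbar : ℝ) (e : (k : ℕ) → (Fin (k + 1) → ℝ) → ℝ) (b : ℕ → ℝ) (θ b₀ b₁ Λ A₀ A a₀' a₁' B : ℝ),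
        0 < ε₀ ∧ 0 < ε₂₉ ∧ 0 < γ ∧ γ ≤ γbar ∧ 0 ≤ θ ∧ 0 ≤ b₀ ∧ 0 ≤ b₁ ∧ 0 ≤ Λ ∧ θ + γ * Λ < 1 ∧ 0 ≤ A ∧ 0 ≤ a₀' ∧ 0 ≤ a₁' ∧
        letI β : HBeta := betaOfRecord₁₃Ax F 2 (theta13OfThm1CCMWZBAx F 2 j (1 / 2) a₀ ε₀ ε₂₉ B₃ B₃' a₀ a₁ (fun _ _ => 0) (fun _ _ => 0))
        (∀ (k : ℕ) (v : Fin (k + 2) → ℝ), v ∈ Box γbar (k + 1) →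
          e (k + 1) v ≤ θ * e k (Fin.init v) + b₀ + v (Fin.last (k + 1)) * (b₁ + Λ * e k (Fin.init v))) ∧
        (∀ v : Fin 1 → ℝ, v ∈ Box γbar 0 → e 0 v ≤ b₀ + v 0 * b₁) ∧
        (∀ v : Fin 1 → ℝ, v ∈ Box γbar 0 → |β 0 v - b 0| ≤ A₀ + v 0 * a₀') ∧
        (∀ (k : ℕ) (v : Fin (k + 2) → ℝ), v ∈ Box γbar (k + 1) →
          |β (k + 1) v - b (k + 1)| ≤ A₀ + A * e k (Fin.init v) + v (Fin.last (k + 1)) * (a₀' + a₁' * e k (Fin.init v))) ∧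
        (∀ k, |b k| ≤ B)) :
    AbsBetaBoxAtThm1WitnessCCMGenGridGZBAxAt F := by
  intro j c c₀ c₁ B₃ B₃' a₀ a₁ _hc _hc₀ _hc₁ hB₃ hB₃' ha₀ ha₁ _h15 _h9
  obtain ⟨ε₀, ε₂₉, γ, γbar, e, b, θ, b₀, b₁, Λ, A₀, A, a₀', a₁', B, hε₀, hε₂₉, hγ, hγbar, hθ, hb₀, hb₁, hΛ, hgap, hA, ha₀', ha₁',
    hstep, hbase, hread0, hread, hcap⟩ := h j B₃ B₃' a₀ a₁ hB₃ hB₃' ha₀ ha₁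
  have hsize := size_le_of_stepLastOn hθ hb₀ hb₁ hΛ hγ.le hγbar hgap hstep hbase
  obtain ⟨hlo, hup⟩ := betaBox_of_readoutOn (gronwall_level_nonneg hb₀ hb₁ hγ.le hgap) hγ.le hγbar hA ha₀' ha₁' hsize hread0 hread hcap
  exact ⟨γ, ε₀, ε₂₉, _, hγ, hε₀, hε₂₉, hlo, hup⟩

/-! ## §2. RADIUS-AXIS EDITION, RE-CENTRED: the rows at ONE re-centred member per SMALL radius ⟹ the body of door (α_small) `K0BoxSmallRadiiAx` at `F`, UNFOLDED
(the named door lives in dag-n07-w3 g22's leaf `…K0V23Stub3DoorSuppliersAx` ✓p809897; composing is one `fun F => …` line there ∕ in the radius-doors Ax edition) -/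

/-- **★★ FLOW ROWS AT ONE RE-CENTRED MEMBER PER SMALL RADIUS ⟹ DOOR (α_small)ᴬˣ AT `F`, UNFOLDED** (σ-image of `K0V23Stub3FlowGronwallDoor.k0BoxSmallRadiiAt_of_flowRowsHist`).
If below some `a⋆ > 0` every background radius `a₀ ∈ ]0, a⋆]` admits ONE re-centred Z3 member `theta13OfThm1CCMWZBAx F 2 j ½ a₀ ε₀ ε₂₉ B₃ B₃′ a₀ a₁ Efl logz` (`ε₂₉ > 0`), box
sides `0 < γ ≤ γ̄` and flow data carrying the FOUR ROWS (full-memory step, base, readout + base readout, cap) for that member's re-centred β of record, then `F` has the body of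
door (α_small)ᴬˣ: `∃ a⋆ > 0, ∀ a₀ ∈ ]0, a⋆], ∃ γ₀ ε₂₉ β′ j ε₀ B₃ B₃′ a₁ Efl logz, 0 < γ₀ ∧ 0 < ε₂₉ ∧ BetaLowerH (−β′) γ₀ βᴬˣ ∧ BetaUpperH β′ γ₀ βᴬˣ` (= the `F`-instance of
`K0V23Stub3DoorSuppliersAx.K0BoxSmallRadiiAx`).  The rows are asked ONLY at radii `≤ a⋆` and at ONE member each.  CONDITIONAL on the rows; nothing of Bałaban asserted; K0ᴬ NOT closed.
[cite: Balaban1987RG1, Thm 1 p.259, Thm 3 p.264, (1.18) p.263, (1.20)–(1.22) p.264, (2.9) p.266; Balaban1989LargeFieldII, p.355] -/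
theorem k0BoxSmallRadiiAxAt_of_flowRowsHist (F : T4Family) {aS : ℝ} (haS : 0 < aS)
    (h : ∀ a₀ : ℝ, 0 < a₀ → a₀ ≤ aS →
      ∃ (j : ℕ) (ε₀ ε₂₉ B₃ B₃' a₁ : ℝ) (Efl logz : B12.RunParams → ℕ → ℝ) (γ γbar : ℝ)
        (e : (k : ℕ) → (Fin (k + 1) → ℝ) → ℝ) (b : ℕ → ℝ) (θ b₀ b₁ Λ A₀ A a₀' a₁' B : ℝ),
        0 < ε₂₉ ∧ 0 < γ ∧ γ ≤ γbar ∧ 0 ≤ θ ∧ 0 ≤ b₀ ∧ 0 ≤ b₁ ∧ 0 ≤ Λ ∧ θ + γ * Λ < 1 ∧ 0 ≤ A ∧ 0 ≤ a₀' ∧ 0 ≤ a₁' ∧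
        letI β : HBeta := betaOfRecord₁₃Ax F 2 (theta13OfThm1CCMWZBAx F 2 j (1 / 2) a₀ ε₀ ε₂₉ B₃ B₃' a₀ a₁ Efl logz)
        (∀ (k : ℕ) (v : Fin (k + 2) → ℝ) (E : ℝ), v ∈ Box γbar (k + 1) → 0 ≤ E →
          (∀ (i : ℕ) (hi : i + 1 ≤ k + 1), e i (fun t => v (Fin.castLE (hi.trans (Nat.le_succ _)) t)) ≤ E) →
          e (k + 1) v ≤ θ * E + b₀ + v (Fin.last (k + 1)) * (b₁ + Λ * E)) ∧
        (∀ v : Fin 1 → ℝ, v ∈ Box γbar 0 → e 0 v ≤ b₀ + v 0 * b₁) ∧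
        (∀ v : Fin 1 → ℝ, v ∈ Box γbar 0 → |β 0 v - b 0| ≤ A₀ + v 0 * a₀') ∧
        (∀ (k : ℕ) (v : Fin (k + 2) → ℝ), v ∈ Box γbar (k + 1) →
          |β (k + 1) v - b (k + 1)| ≤ A₀ + A * e k (Fin.init v) + v (Fin.last (k + 1)) * (a₀' + a₁' * e k (Fin.init v))) ∧
        (∀ k, |b k| ≤ B)) :
    ∃ aS : ℝ, 0 < aS ∧ ∀ a₀ : ℝ, 0 < a₀ → a₀ ≤ aS →
      ∃ (γ₀ ε₂₉ β' : ℝ) (j : ℕ) (ε₀ B₃ B₃' a₁ : ℝ) (Efl logz : B12.RunParams → ℕ → ℝ), 0 < γ₀ ∧ 0 < ε₂₉ ∧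
        BetaLowerH (-β') γ₀ (betaOfRecord₁₃Ax F 2 (theta13OfThm1CCMWZBAx F 2 j (1 / 2) a₀ ε₀ ε₂₉ B₃ B₃' a₀ a₁ Efl logz)) ∧
        BetaUpperH β' γ₀ (betaOfRecord₁₃Ax F 2 (theta13OfThm1CCMWZBAx F 2 j (1 / 2) a₀ ε₀ ε₂₉ B₃ B₃' a₀ a₁ Efl logz)) := by
  refine ⟨aS, haS, fun a₀ ha₀ hle => ?_⟩
  obtain ⟨j, ε₀, ε₂₉, B₃, B₃', a₁, Efl, logz, γ, γbar, e, b, θ, b₀, b₁, Λ, A₀, A, a₀', a₁', B, hε₂₉, hγ, hγbar, hθ, hb₀, hb₁, hΛ, hgap, hA, ha₀',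
    ha₁', hstep, hbase, hread0, hread, hcap⟩ := h a₀ ha₀ hle
  obtain ⟨hlo, hup⟩ := betaBox_of_flowRowsHistOn hθ hb₀ hb₁ hΛ hγ.le hγbar hgap hA ha₀' ha₁' hstep hbase hread0 hread hcap
  exact ⟨γ, ε₂₉, _, j, ε₀, B₃, B₃', a₁, Efl, logz, hγ, hε₂₉, hlo, hup⟩

end Summit.QuantumFields.YangMills.Theorems.K0V23Stub3FlowGronwallDoorAx

end
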